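import Literature.MathematicalPhysics.QuantumFieldTheory.Balaban1983to89.B2Lemma25Proof

/-!
# `Balaban1983to89.B2Lemma23Proof` — [Balaban1982Higgs2] **Lemma 2.3** (2.59)–(2.60) p. 571 and its printed proof
# (2.61)–(2.64): the decomposition (2.61) and its derivative form (2.64) as exact kernel identities, the `O(p)` estimates
# «using Proposition 2.2 and the restrictions (2.55)» and «the properties of the function ζ^{(k)}» KERNEL-CHECKED over
# matrix coordinates, and the row's decl of record `B2Sect2Statements.Lemma23Printed` (+ the twin `B2StepK.Lemma23Printed`)
# PROVED for that model family

statement-level skeleton of published theorems with citation tags; proofs where landed; nothing here is a claim about the Yang–Mills mass gap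

CITATION HEADER.  T. Bałaban, *(Higgs)₂,₃ quantum fields in a finite volume. II. An upper bound*, Commun. Math. Phys.
**86** (1982) 555–594, doi:10.1007/bf01214890 [Balaban1982Higgs2] (cell paper B2; PDF held
`paper:balaban1982-cmp86-higgs23-ii`, journal page = PDF page + 554; pp. 566, 569–571 READ AS IMAGES on the ×2 renders
`run/shared/lean/pub/pub-balaban/b2b-balaban-ref1/pages/1982-cmp86-higgs23-II/1982-cmp86-higgs23-II-p012/p015/p016/p017-x2.png`).
Cell `lit-balaban` (HOME `run/shared/lean/pub/lit-balaban/`), Phase-2 proof seat **p23** gen 4, unit `lit-balaban-p23-g4`;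
SKELETON row **B2.Lem2.3** (decl of record `…B2Sect2Statements.Lemma23Printed`, r02 p239259; twin `…B2StepK.Lemma23Printed`,
r14 p239461; both UNCHANGED here), kind «model instance» (PHASE2-TARGETS §G.1); fold owner r02, referee ref-4.  The
module-algebra forms of (2.61) and (2.62)–(2.63) are r14's `…B2StepK.display261` and `…B2.display263` (REUSED by reference,
not restated: here (2.61) is the finite-sum identity `eq261`, and the VALUE (2.63) of a_kG_kQ_k^*1 enters the builder
`kappa_of_display263`); the decay-kernel engine is `…B2Lemma25Proof.far_sum_bound` / `lipschitz_sum_bound` (p247392).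

WHAT IS PRINTED (verbatim).  p. 566 [PDF 12]: *"A^{(k),ε} = a_k(L^kε)⁻²ζ^{(k)}G^ε_kQ_k^*A, (2.44) where the function
ζ^{(k)}(x, y) is defined for x ∈ T_η, y ∈ T₁^{(k)}, is "smooth" with respect to x in the sense that |(∂^η_xζ^{(k)})(b, y)| ≦ 1,
supp ζ^{(k)}(·, y) is contained in the set {x ∈ T_η : |x − y| < r(L^kε) − 2M} and ζ^{(k)}(x, y) = 1 if |x − y| ≦ ½r(L^kε)."*
p. 569 [PDF 15]: *"Let us recall the formula for A^{(k)} after the rescaling A^{(k)} = a_kζ^{(k)}G_kQ_k^*A, (2.54)"*; p. 570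
[PDF 16]: *"and the restrictions on the fields A, φ given by the characteristic functions χ_k: |(∂A)(b)| ≦ c₁p(L^{k−1}ε),
|A(x)| ≦ (c₁/(μ₀L^{k−1}ε))p(L^{k−1}ε), … b ⊂ Λ^{(k−1)′}₋₁ (2.55)"*; Proposition 2.2 p. 570–571: *"|(D^η_AG_k(Ω, A)Q_k^*(A))(b, y)|
≦ c₀exp(−δ₀dist(b, y)), (2.58) for b ⊂ Ω, dist(b, Ω^c) ≧ R₀, y ∈ Ω^{(k)}. The identical inequality holds for G_k(Ω, A)Q_k^*(A)
…"*.  p. 571 [PDF 17]: *"**Lemma 2.3.** Under the restrictions (2.55), we have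
A^{(k)}(x) = A(y) + O(p(L^kε)) = (Q_k^*A)(x) + O(p(L^kε)),  x ∈ B^k(y),  y ∈ Λ₂^{(k−1)′}, (2.59)
(∂^η_μA^{(k)})(x) = O(p(L^kε)),  x ∈ B^k(Λ₂^{(k−1)′}). (2.60)
Let us notice that the conclusions of Proposition 2.2 hold for G_kQ_k^*. We have
A^{(k)}(x) = a_k(ζ^{(k)}G_kQ_k^*(A − A(y)))(x) − a_k((1 − ζ^{(k)})G_kQ_k^*1)(x)A(y) + a_k(G_kQ_k^*1)(x)A(y),  x ∈ B^k(y),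
y ∈ Λ₂^{(k−1)′}. (2.61)  Using Proposition 2.2 and the restrictions (2.55) we can estimate the first two terms in (2.61) by
O(1)p(L^kε). The third term can be calculated in the following way G_kQ_k^*1 = a_k⁻¹G_ka_kP_kQ_k^*1 = a_k⁻¹G_k(−Δ^η + μ₀²(L^kε)²
+ a_kP_k)1 − (μ₀²(L^kε)²/a_k)G_kQ_k^*1. (2.62) Hence (a_kG_kQ_k^*1)(x) = 1 − μ₀²(L^kε)²/(a_k + μ₀²(L^kε)²), (2.63) and, again
using (2.55), we have (2.59). Furthermore, because G_kQ_k^*1 is a constant, from (2.61) we have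
(∂^η_μA^{(k)})(x) = a_k(∂^η_μζ^{(k)}G_kQ_k^*(A − A(y)))(x) − a_k(∂^η_μ(1 − ζ^{(k)})G_kQ_k^*1)(x)A(y),  x ∈ B^k(y),  y ∈ Λ₂^{(k−1)′},
(2.64) and the restrictions (2.55), Proposition 2.2 and the properties of the function ζ^{(k)} imply (2.60). Thus Lemma 2.3
is proved."*

THE MODEL (matrix coordinates; the same dictionary as `B2Lemma25Proof`: weight-1 reading `(Q_k^*A)(x) = A(y)` for `x ∈ B^k(y)`,
the reading in which (2.59) says `= A(y) + O(p) = (Q_k^*A)(x) + O(p)`).  ONE INSTANCE (`KernelModel23 P X Y Dir`) = one step k: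
`X` ↤ the fine points of T_η, `Y` ↤ the sites of the unit lattice T₁^{(k)} (where `A` lives), `Dir` ↤ the directions μ;
`T : Finset Y` ↤ the sites summed over; `good : Finset X` ↤ B^k(Λ₂^{(k−1)′}); `blk x` ↤ the y with x ∈ B^k(y) (`blk_mem`);
`sh μ x` ↤ x + ηe_μ and `η` ↤ η = L^{−k} (so `(∂^η_μf)(x) = η⁻¹(f(x + ηe_μ) − f(x))`); `K x y′` ↤ a_k(G_kQ_k^*)(x, y′) (the
factor a_k folded into the kernel); `ζ x y′` ↤ ζ^{(k)}(x, y′), so that by (2.54) `A^{(k)}(x) = Σ_{y′} ζ(x,y′)K(x,y′)A(y′)` (`Ak`)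
and «(1 − ζ^{(k)})G_kQ_k^*1» is `Σ_{y′} K(x,y′)(1 − ζ(x,y′))`; `d x y′` ↤ |x − y′| (`d_nonneg`; a shift by ηe_μ moves it by at
most η ≤ 1: `d_le_sh`, `sh_le_d`); `A` ↤ the field A of (2.55); `κ` ↤ the number a_kG_kQ_k^*1 of (2.63) (`sumK`, `sumK_sh`:
the row sums of `K` at the points used); `ρ` ↤ r(L^kε) − 2M and `ρ₁` ↤ ½r(L^kε) (the radii of (2.44): `zeta_supp`,
`zeta_one`; `zeta_abs` |ζ| ≤ 1 and `zeta_lip` |∂^η_xζ| ≤ 1); `p` ↤ p(L^kε), `q` ↤ p(L^{k−1}ε) with `q_le : q ≤ K₃·p` (the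
one-scale comparison of p(·) that the printed «O(p(L^kε))» under restrictions at p(L^{k−1}ε) uses); `tA` ↤ the threshold
c₁/(μ₀L^{k−1}ε) of (2.55)₂.  The Proposition 2.2 shapes (2.58) for G_kQ_k^* and ∂^ηG_kQ_k^* are FIELDS of the instance
(`kerK`, `kerK_sh`, `kerDK` — hypotheses, exactly as `B2Sect2Statements.Prop22Printed` is a `Prop` over abstract carriers);
the restrictions (2.55) form the predicate `KernelModel23.Restr` = the `restr255` of the row's carrier ((2.55)₂ on `T`, and
(2.55)₁ in integrated form along lattice paths: |A(y′) − A(y)| ≤ q(r₁ + r₂|x − y′|) for the sites within the range of ζ).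
The FIXED constants of the family (`Consts23`): `c₀`, `δ` ↤ a_kc₀ (a_k ≤ a), δ₀ of Prop. 2.2; `S` ↤ a bound for the sums
Σ_{y′}exp(−½δ₀|x − y′|) (on ℤ^ν see `B2Lemma25Proof.summable_field_Zd`); `r₁`, `r₂` ↤ the integrated (2.55)₁; `K₁` ↤ a
bound for |κ − 1|·tA ((2.63): μ₀²ℓ²/(a_k + μ₀²ℓ²)·c₁L/(μ₀ℓ) ≤ c₁L/a_k once μ₀ℓ ≤ 1, ℓ = L^kε — `kappa_of_display263`); `K₂` ↤
a bound for exp(−½δ₀(ρ₁ − 1))·tA (r(L^kε) beats (μ₀L^{k−1}ε)⁻¹ — `sep23_of_rDecay` from r14's `RDecayBeatsPowers`); `K₃` ↤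
the scale comparison.

WHAT IS PROVED.  §0 two more engine lemmas (a far-supported kernel; the shift of a decay bound by one lattice step); §1
**(2.61)** and **(2.64)** as exact identities of finite sums (`eq261`, `eq264`); §2 the estimates: `term1_59`, `term2_59`,
`term3_59` ⇒ **(2.59) pointwise** (`lemma23_pointwise`, `lemma23_pointwise_QsA`: |A^{(k)}(x) − A(y)| ≤ 𝒞·p(L^kε) on
B^k(Λ₂^{(k−1)′})) and `dzeta_bound`, `term1_64`, `term2_64` ⇒ **(2.60) pointwise** (`lemma23_deriv_pointwise`:
|(∂^η_μA^{(k)})(x)| ≤ 𝒞·p(L^kε)), with the explicit 𝒞 = `Consts23.O1`; §3 **row B2.Lem2.3**: `lemma23Printed_model :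
B2Sect2Statements.Lemma23Printed (famOf P X Y Dir)` and the twin `lemma23Printed_model_StepK : B2StepK.Lemma23Printed
(famOfStepK P X Y Dir)` for the family of ALL instances with constants `P`; §4 the discharges `kappa_of_display263` ((2.63) ⇒
the `K₁` field) and `sep23_of_rDecay` / `exists_C₁_rDecay4` (⇒ the `K₂` field).  NOT CLAIMED: Proposition 2.2 itself (an
input, as in print), the identification of the abstract kernels with Bałaban's a_kG_kQ_k^*, the operator identity (2.62)
(r14/`B2.display263` give (2.63) as module algebra; here its value is an input of `kappa_of_display263`).  No `sorry`, no new
`def … : Prop` leaf; axioms standard.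
-/

namespace Literature.MathematicalPhysics.QuantumFieldTheory.Balaban1983to89.B2Lemma23Proof

open Finset Real
open Literature.MathematicalPhysics.QuantumFieldTheory.Balaban1983to89
open Literature.MathematicalPhysics.QuantumFieldTheory.Balaban1983to89.B2Lemma25Proof (far_sum_bound lipschitz_sum_bound)

/-! ## §0. Two more engine lemmas -/

section Engine

variable {Y : Type*}

/-- ENGINE 1′ (a far-supported decaying kernel): if `|K(y′)| ≤ c₀e^{−δd(y′)}` and `K(y′) = 0` unless `R ≤ d(y′)`, then
`|Σ K| ≤ c₀·e^{−(δ/2)R}·Σe^{−(δ/2)d}` — the estimate behind the second term of (2.64) («the properties of the function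
ζ^{(k)}»: ∂^η_x((1 − ζ^{(k)})G_kQ_k^*)(·, y′) vanishes for |x − y′| ≤ ½r(L^kε) − 1). [cite: Balaban1982Higgs2, (2.64) p.571] -/
theorem far_kernel_sum_bound {S : Finset Y} {K d : Y → ℝ} {c₀ δ R Ssum : ℝ} (hc₀ : 0 ≤ c₀) (hδ : 0 ≤ δ)
    (hK : ∀ y ∈ S, |K y| ≤ c₀ * Real.exp (-(δ * d y))) (hfar : ∀ y ∈ S, K y ≠ 0 → R ≤ d y)
    (hS : ∑ y ∈ S, Real.exp (-(δ / 2 * d y)) ≤ Ssum) :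
    |∑ y ∈ S, K y| ≤ c₀ * Real.exp (-(δ / 2 * R)) * Ssum := by
  have hterm : ∀ y ∈ S, |K y| ≤ c₀ * Real.exp (-(δ / 2 * R)) * Real.exp (-(δ / 2 * d y)) := by
    intro y hy
    by_cases h0 : K y = 0
    · rw [h0, abs_zero]; positivity
    · have hRd := hfar y hy h0
      have h1 : Real.exp (-(δ * d y)) ≤ Real.exp (-(δ / 2 * R)) * Real.exp (-(δ / 2 * d y)) := by
        rw [← Real.exp_add, Real.exp_le_exp]
        nlinarith [mul_nonneg hδ (sub_nonneg.mpr hRd)]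
      calc |K y| ≤ c₀ * Real.exp (-(δ * d y)) := hK y hy
        _ ≤ c₀ * (Real.exp (-(δ / 2 * R)) * Real.exp (-(δ / 2 * d y))) := mul_le_mul_of_nonneg_left h1 hc₀
        _ = c₀ * Real.exp (-(δ / 2 * R)) * Real.exp (-(δ / 2 * d y)) := by ring
  calc |∑ y ∈ S, K y| ≤ ∑ y ∈ S, |K y| := Finset.abs_sum_le_sum_abs _ _
    _ ≤ ∑ y ∈ S, c₀ * Real.exp (-(δ / 2 * R)) * Real.exp (-(δ / 2 * d y)) := Finset.sum_le_sum hterm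
    _ = c₀ * Real.exp (-(δ / 2 * R)) * ∑ y ∈ S, Real.exp (-(δ / 2 * d y)) := by rw [Finset.mul_sum]
    _ ≤ c₀ * Real.exp (-(δ / 2 * R)) * Ssum := mul_le_mul_of_nonneg_left hS (by positivity)

/-- A shift by one lattice step costs a factor `e^{δ}` in a decay bound: `d ≤ d′ + 1 ⇒ e^{−δd′} ≤ e^{δ}·e^{−δd}` (`δ ≥ 0`).
[cite: Balaban1982Higgs2, (2.64) p.571] -/
theorem exp_neg_shift_le {δ d d' : ℝ} (hδ : 0 ≤ δ) (h : d ≤ d' + 1) :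
    Real.exp (-(δ * d')) ≤ Real.exp δ * Real.exp (-(δ * d)) := by
  rw [← Real.exp_add, Real.exp_le_exp]
  nlinarith [mul_le_mul_of_nonneg_left h hδ]

end Engine

/-! ## §1. (2.61) and (2.64): the decompositions as exact kernel identities -/

section Identity

variable {Y : Type*}

/-- **(2.61)** p. 571 [PDF 17], as an EXACT identity of finite sums (the fine point `x` is fixed and suppressed: `ζ y′` ↤
ζ^{(k)}(x, y′), `K y′` ↤ a_k(G_kQ_k^*)(x, y′), `c` ↤ A(y)):
`A^{(k)}(x) = Σ_{y′}ζK(A(y′) − A(y)) − (Σ_{y′}K(1 − ζ))·A(y) + (Σ_{y′}K)·A(y)`, i.e.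
a_k(ζ^{(k)}G_kQ_k^*(A − A(y)))(x) − a_k((1 − ζ^{(k)})G_kQ_k^*1)(x)A(y) + a_k(G_kQ_k^*1)(x)A(y).  (Module-algebra form: r14's
`B2StepK.display261`.) [cite: Balaban1982Higgs2, (2.61) p.571] -/
theorem eq261 (T : Finset Y) (ζ K A : Y → ℝ) (c : ℝ) :
    ∑ y' ∈ T, ζ y' * K y' * A y' =
      ∑ y' ∈ T, ζ y' * K y' * (A y' - c) - (∑ y' ∈ T, K y' * (1 - ζ y')) * c + (∑ y' ∈ T, K y') * c := by
  have h : ∀ y' ∈ T, ζ y' * K y' * A y' =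
      ζ y' * K y' * (A y' - c) - K y' * (1 - ζ y') * c + K y' * c := fun _ _ => by ring
  rw [Finset.sum_congr rfl h, Finset.sum_add_distrib, Finset.sum_sub_distrib, Finset.sum_mul, Finset.sum_mul]

/-- **(2.64)** p. 571, as an EXACT identity of finite sums: the difference quotient `η⁻¹(A^{(k)}(x + ηe_μ) − A^{(k)}(x))` of
(2.54) (`ζ′, K′` ↤ the kernels at the shifted point `x + ηe_μ`, `ζ, K` at `x`, `c` ↤ A(y)) equals
`Σ_{y′}η⁻¹(ζ′K′ − ζK)(A(y′) − A(y)) − (Σ_{y′}η⁻¹(K′(1 − ζ′) − K(1 − ζ)))·A(y) + η⁻¹(Σ_{y′}K′ − Σ_{y′}K)·A(y)` — the printed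
(2.64) is this with the last term dropped «because G_kQ_k^*1 is a constant». [cite: Balaban1982Higgs2, (2.64) p.571] -/
theorem eq264 (T : Finset Y) (ζ K ζ' K' A : Y → ℝ) (c η : ℝ) :
    η⁻¹ * (∑ y' ∈ T, ζ' y' * K' y' * A y' - ∑ y' ∈ T, ζ y' * K y' * A y') =
      ∑ y' ∈ T, η⁻¹ * (ζ' y' * K' y' - ζ y' * K y') * (A y' - c)
        - (∑ y' ∈ T, η⁻¹ * (K' y' * (1 - ζ' y') - K y' * (1 - ζ y'))) * c
        + η⁻¹ * (∑ y' ∈ T, K' y' - ∑ y' ∈ T, K y') * c := by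
  rw [eq261 T ζ' K' A c, eq261 T ζ K A c]
  simp only [Finset.mul_sum, Finset.sum_mul, ← Finset.sum_sub_distrib, ← Finset.sum_add_distrib, mul_add, mul_sub]
  exact Finset.sum_congr rfl fun _ _ => by ring

end Identity

/-! ## §2. The model of one step and Lemma 2.3 pointwise -/

/-- The FIXED constants of the model family (chosen before the instance, so that the `O(·)` of (2.59)–(2.60) is uniform):
`c₀`, `δ` ↤ a_kc₀, δ₀ of Proposition 2.2 (2.58) for G_kQ_k^* and ∂^ηG_kQ_k^*; `S` ↤ a bound for Σ_{y′}e^{−½δ₀|x−y′|}; `r₁`, `r₂`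
↤ the integrated restriction (2.55)₁; `K₁` ↤ a bound for |a_kG_kQ_k^*1 − 1|·c₁/(μ₀L^{k−1}ε) ((2.63)); `K₂` ↤ a bound for
e^{−½δ₀(½r(L^kε) − 1)}·c₁/(μ₀L^{k−1}ε); `K₃` ↤ a bound for p(L^{k−1}ε)/p(L^kε). [cite: Balaban1982Higgs2, Lemma 2.3 p.571] -/
structure Consts23 where
  c₀ : ℝ
  δ : ℝ
  S : ℝ
  r₁ : ℝ
  r₂ : ℝ
  K₁ : ℝ
  K₂ : ℝ
  K₃ : ℝ

/-- The sign conditions on the fixed constants. [cite: Balaban1982Higgs2, Lemma 2.3 p.571] -/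
structure Consts23.Valid (P : Consts23) : Prop where
  c₀_nonneg : 0 ≤ P.c₀
  δ_pos : 0 < P.δ
  S_nonneg : 0 ≤ P.S
  r₁_nonneg : 0 ≤ P.r₁
  r₂_nonneg : 0 ≤ P.r₂
  K₁_nonneg : 0 ≤ P.K₁
  K₂_nonneg : 0 ≤ P.K₂
  K₃_nonneg : 0 ≤ P.K₃

/-- The `O(1)` of (2.59) at scale p(L^{k−1}ε): `K₁ + c₀S(2K₂ + r₁ + 2r₂/δ₀)` (terms 3, 2, 1 of (2.61)).
[cite: Balaban1982Higgs2, (2.59) p.571] -/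
noncomputable def Consts23.O59 (P : Consts23) : ℝ := P.K₁ + P.c₀ * P.S * (2 * P.K₂ + P.r₁ + P.r₂ * (2 / P.δ))

/-- The `O(1)` of (2.60) at scale p(L^{k−1}ε): `c₀S((e^{δ₀} + 1)(r₁ + 2r₂/δ₀) + (e^{δ₀} + 2)K₂)` (terms 1, 2 of (2.64)).
[cite: Balaban1982Higgs2, (2.60) p.571] -/
noncomputable def Consts23.O60 (P : Consts23) : ℝ :=
  P.c₀ * P.S * ((Real.exp P.δ + 1) * (P.r₁ + P.r₂ * (2 / P.δ)) + (Real.exp P.δ + 2) * P.K₂)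

/-- The explicit `O(1)` constant of Lemma 2.3 for the model family: `𝒞 = K₃·(O59 + O60)`.
[cite: Balaban1982Higgs2, Lemma 2.3 (2.59)–(2.60) p.571] -/
noncomputable def Consts23.O1 (P : Consts23) : ℝ := P.K₃ * (P.O59 + P.O60)

/-- `O59 ≥ 0`. [cite: Balaban1982Higgs2, (2.59) p.571] -/
theorem Consts23.O59_nonneg {P : Consts23} (hP : P.Valid) : 0 ≤ P.O59 := by
  have := hP.c₀_nonneg; have := hP.δ_pos; have := hP.S_nonneg; have := hP.r₁_nonneg; have := hP.r₂_nonneg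
  have := hP.K₁_nonneg; have := hP.K₂_nonneg
  unfold Consts23.O59; positivity

/-- `O60 ≥ 0`. [cite: Balaban1982Higgs2, (2.60) p.571] -/
theorem Consts23.O60_nonneg {P : Consts23} (hP : P.Valid) : 0 ≤ P.O60 := by
  have := hP.c₀_nonneg; have := hP.δ_pos; have := hP.S_nonneg; have := hP.r₁_nonneg; have := hP.r₂_nonneg
  have := hP.K₂_nonneg
  unfold Consts23.O60; positivity

/-- `𝒞 ≥ 0`. [cite: Balaban1982Higgs2, Lemma 2.3 (2.59)–(2.60) p.571] -/
theorem Consts23.O1_nonneg {P : Consts23} (hP : P.Valid) : 0 ≤ P.O1 := by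
  have := Consts23.O59_nonneg hP; have := Consts23.O60_nonneg hP; have := hP.K₃_nonneg
  unfold Consts23.O1; positivity

/-- ONE INSTANCE of Lemma 2.3 in matrix coordinates (module docstring, THE MODEL): the fine points `X`, the unit-lattice
sites `Y` carrying `A`, the directions `Dir`; the summed sites `T`, the points `good` = B^k(Λ₂^{(k−1)′}) with their blocks
`blk`, the shifts `sh μ` by ηe_μ, the kernel `K` = a_k(G_kQ_k^*)(x,y′) with the Proposition 2.2 shapes (2.58) as the fields
`kerK`/`kerK_sh` (the kernel) and `kerDK` (its ∂^η_x), the cutoff `ζ` = ζ^{(k)} of (2.44) with its printed properties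
(`zeta_abs`, `zeta_supp`, `zeta_one`, `zeta_lip`), the row sums (2.63) (`sumK`, `sumK_sh`), the scales `p` = p(L^kε),
`q` = p(L^{k−1}ε), `tA` = c₁/(μ₀L^{k−1}ε) and the two scale bounds `kappa` ((2.63) against tA) and `sep` (the radius ½r(L^kε)
against tA).  The restrictions (2.55) on `A` are NOT fields: they form the predicate `Restr`.
[cite: Balaban1982Higgs2, (2.44) p.566, (2.54)–(2.55) pp.569–570, (2.58) p.570, (2.61)–(2.64) p.571] -/
structure KernelModel23 (P : Consts23) (X Y Dir : Type) where
  /-- the sites of T₁^{(k)} summed over -/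
  T : Finset Y
  /-- the fine points of B^k(Λ₂^{(k−1)′}) -/
  good : Finset X
  /-- x ↦ the y with x ∈ B^k(y) -/
  blk : X → Y
  /-- x ↦ x + ηe_μ -/
  sh : Dir → X → X
  /-- the fine lattice spacing η = L^{−k} -/
  η : ℝ
  /-- a_k(G_kQ_k^*)(x, y′) -/
  K : X → Y → ℝ
  /-- ζ^{(k)}(x, y′) of (2.44) -/
  ζ : X → Y → ℝ
  /-- |x − y′| -/
  d : X → Y → ℝ
  /-- the field A of (2.55) on the unit lattice -/
  A : Y → ℝ
  /-- the number a_kG_kQ_k^*1 of (2.63) -/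
  κ : ℝ
  /-- the support radius r(L^kε) − 2M of ζ^{(k)}(·, y) -/
  ρ : ℝ
  /-- the radius ½r(L^kε) within which ζ^{(k)} = 1 -/
  ρ₁ : ℝ
  /-- p(L^kε) -/
  p : ℝ
  /-- p(L^{k−1}ε) -/
  q : ℝ
  /-- the threshold c₁/(μ₀L^{k−1}ε) of (2.55)₂ -/
  tA : ℝ
  blk_mem : ∀ x ∈ good, blk x ∈ T
  η_pos : 0 < η
  d_nonneg : ∀ x y', 0 ≤ d x y'
  /-- |x − y′| ≤ |(x + ηe_μ) − y′| + 1 -/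
  d_le_sh : ∀ μ x y', d x y' ≤ d (sh μ x) y' + 1
  /-- |(x + ηe_μ) − y′| ≤ |x − y′| + 1 -/
  sh_le_d : ∀ μ x y', d (sh μ x) y' ≤ d x y' + 1
  /-- (2.58) for G_kQ_k^*: |a_k(G_kQ_k^*)(x, y′)| ≤ c₀e^{−δ₀|x−y′|} at the good points -/
  kerK : ∀ x ∈ good, ∀ y' ∈ T, |K x y'| ≤ P.c₀ * Real.exp (-(P.δ * d x y'))
  /-- the same at the shifted points x + ηe_μ -/
  kerK_sh : ∀ μ, ∀ x ∈ good, ∀ y' ∈ T, |K (sh μ x) y'| ≤ P.c₀ * Real.exp (-(P.δ * d (sh μ x) y'))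
  /-- (2.58) for ∂^ηG_kQ_k^*: |a_k(∂^η_{x,μ}G_kQ_k^*)(x, y′)| ≤ c₀e^{−δ₀|x−y′|}, i.e. |K(x+ηe_μ, y′) − K(x, y′)| ≤ ηc₀e^{−δ₀|x−y′|} -/
  kerDK : ∀ μ, ∀ x ∈ good, ∀ y' ∈ T, |K (sh μ x) y' - K x y'| ≤ η * (P.c₀ * Real.exp (-(P.δ * d x y')))
  /-- |ζ^{(k)}| ≤ 1 -/
  zeta_abs : ∀ x y', |ζ x y'| ≤ 1
  /-- supp ζ^{(k)}(·, y′) ⊂ {|x − y′| < r(L^kε) − 2M} -/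
  zeta_supp : ∀ x, ∀ y' ∈ T, ζ x y' ≠ 0 → d x y' ≤ ρ
  /-- ζ^{(k)}(x, y′) = 1 if |x − y′| ≤ ½r(L^kε) -/
  zeta_one : ∀ x, ∀ y' ∈ T, d x y' ≤ ρ₁ → ζ x y' = 1
  /-- |(∂^η_xζ^{(k)})(b, y′)| ≤ 1 -/
  zeta_lip : ∀ μ x, ∀ y' ∈ T, |ζ (sh μ x) y' - ζ x y'| ≤ η
  /-- (2.63): a_kG_kQ_k^*1 is the constant κ, at the good points -/
  sumK : ∀ x ∈ good, ∑ y' ∈ T, K x y' = κ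
  /-- and at the shifted points -/
  sumK_sh : ∀ μ, ∀ x ∈ good, ∑ y' ∈ T, K (sh μ x) y' = κ
  p_nonneg : 0 ≤ p
  q_nonneg : 0 ≤ q
  /-- p(L^{k−1}ε) ≤ K₃·p(L^kε) -/
  q_le : q ≤ P.K₃ * p
  tA_nonneg : 0 ≤ tA
  /-- (2.63) against the threshold of (2.55)₂: |κ − 1|·c₁/(μ₀L^{k−1}ε) ≤ K₁ (`kappa_of_display263`) -/
  kappa : |κ - 1| * tA ≤ P.K₁
  /-- the radius ½r(L^kε) beats the threshold: e^{−½δ₀(ρ₁ − 1)}·c₁/(μ₀L^{k−1}ε) ≤ K₂ (`sep23_of_rDecay`) -/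
  sep : Real.exp (-(P.δ / 2 * (ρ₁ - 1))) * tA ≤ P.K₂
  /-- the volume constant: Σ_{y′∈T}e^{−½δ₀|x−y′|} ≤ S at every point -/
  summable : ∀ x, ∑ y' ∈ T, Real.exp (-(P.δ / 2 * d x y')) ≤ P.S

namespace KernelModel23

variable {P : Consts23} {X Y Dir : Type} (m : KernelModel23 P X Y Dir)

/-- «the restrictions (2.55)» on the field A (p. 570): (2.55)₂ `|A(y′)| ≤ (c₁/(μ₀L^{k−1}ε))p(L^{k−1}ε)` on the summed sites,
and (2.55)₁ `|(∂A)(b)| ≤ c₁p(L^{k−1}ε)` in integrated form along lattice paths of T₁^{(k)} — for the sites within the range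
of ζ^{(k)}(x, ·) (plus one step): `|A(y′) − A(y)| ≤ p(L^{k−1}ε)(r₁ + r₂|x − y′|)`, `x ∈ B^k(y)`.
[cite: Balaban1982Higgs2, (2.55) p.570; Lemma 2.3 p.571] -/
structure Restr : Prop where
  /-- (2.55)₂ -/
  bound : ∀ y' ∈ m.T, |m.A y'| ≤ m.tA * m.q
  /-- (2.55)₁, integrated -/
  lipschitz : ∀ x ∈ m.good, ∀ y' ∈ m.T, m.d x y' ≤ m.ρ + 1 →
    |m.A y' - m.A (m.blk x)| ≤ m.q * (P.r₁ + P.r₂ * m.d x y')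

/-- **(2.54)** `A^{(k)}(x) = a_k(ζ^{(k)}G_kQ_k^*A)(x) = Σ_{y′}ζ^{(k)}(x,y′)·a_k(G_kQ_k^*)(x,y′)·A(y′)` in the model (one component).
[cite: Balaban1982Higgs2, (2.54) p.569; (2.44) p.566] -/
def Ak (x : X) : ℝ := ∑ y' ∈ m.T, m.ζ x y' * m.K x y' * m.A y'

/-- `(Q_k^*A)(x) = A(y)` for `x ∈ B^k(y)` (weight-1 reading, the reading in which (2.59) states `A(y) + O(p) = (Q_k^*A)(x) + O(p)`).
[cite: Balaban1982Higgs2, (2.59) p.571] -/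
def QsA (x : X) : ℝ := m.A (m.blk x)

/-- `(∂^η_μA^{(k)})(x) = η⁻¹(A^{(k)}(x + ηe_μ) − A^{(k)}(x))`. [cite: Balaban1982Higgs2, (2.60) p.571] -/
noncomputable def dAk (μ : Dir) (x : X) : ℝ := m.η⁻¹ * (m.Ak (m.sh μ x) - m.Ak x)

/-! ### The three terms of (2.61) -/

/-- TERM 1 of (2.61): `|a_k(ζ^{(k)}G_kQ_k^*(A − A(y)))(x)| ≤ c₀(r₁ + 2r₂/δ₀)S·p(L^{k−1}ε)` — Proposition 2.2 for G_kQ_k^*, |ζ| ≤ 1,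
the support of ζ^{(k)}(x, ·) and the integrated restriction (2.55)₁ (ENGINE 2 of `B2Lemma25Proof`).
[cite: Balaban1982Higgs2, (2.61) p.571; (2.55) p.570; (2.58) p.570] -/
theorem term1_59 (hP : P.Valid) (hR : m.Restr) {x : X} (hx : x ∈ m.good) :
    |∑ y' ∈ m.T, m.ζ x y' * m.K x y' * (m.A y' - m.A (m.blk x))| ≤
      P.c₀ * m.q * (P.r₁ + P.r₂ * (2 / P.δ)) * P.S := by
  set near := m.T.filter (fun y' => m.d x y' ≤ m.ρ + 1) with hnear
  -- outside the range of ζ the summand vanishes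
  have hrestrict : ∑ y' ∈ near, m.ζ x y' * m.K x y' * (m.A y' - m.A (m.blk x)) =
      ∑ y' ∈ m.T, m.ζ x y' * m.K x y' * (m.A y' - m.A (m.blk x)) := by
    refine Finset.sum_filter_of_ne fun y' hy' hne => ?_
    have hζ : m.ζ x y' ≠ 0 := by
      intro h0; apply hne; rw [h0]; ring
    linarith [m.zeta_supp x y' hy' hζ]
  have hsumNear : ∑ y' ∈ near, Real.exp (-(P.δ / 2 * m.d x y')) ≤ P.S :=
    le_trans (Finset.sum_le_sum_of_subset_of_nonneg (Finset.filter_subset _ _) fun _ _ _ => (Real.exp_pos _).le)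
      (m.summable x)
  rw [← hrestrict]
  have h := lipschitz_sum_bound (S := near) (K := fun y' => m.ζ x y' * m.K x y') (g := fun y' => m.A y' - m.A (m.blk x))
    (d := fun y' => m.d x y') hP.c₀_nonneg hP.δ_pos m.q_nonneg hP.r₁_nonneg hP.r₂_nonneg (fun y' _ => m.d_nonneg x y')
    ?_ ?_ hsumNear
  · simpa using h
  · intro y' hy'
    have hyT : y' ∈ m.T := (Finset.mem_filter.mp hy').1
    calc |m.ζ x y' * m.K x y'| = |m.ζ x y'| * |m.K x y'| := abs_mul _ _
      _ ≤ 1 * (P.c₀ * Real.exp (-(P.δ * m.d x y'))) :=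
          mul_le_mul (m.zeta_abs x y') (m.kerK x hx y' hyT) (abs_nonneg _) zero_le_one
      _ = P.c₀ * Real.exp (-(P.δ * m.d x y')) := one_mul _
  · intro y' hy'
    obtain ⟨hyT, hle⟩ := Finset.mem_filter.mp hy'
    exact hR.lipschitz x hx y' hyT hle

/-- TERM 2 of (2.61): `|a_k((1 − ζ^{(k)})G_kQ_k^*1)(x)·A(y)| ≤ 2c₀SK₂·p(L^{k−1}ε)` — (1 − ζ^{(k)})(x, ·) vanishes within ½r(L^kε)
of x, beyond it Proposition 2.2 gives e^{−½δ₀·½r}, which beats |A(y)| ≤ c₁/(μ₀L^{k−1}ε)·p (ENGINE 1 of `B2Lemma25Proof`).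
[cite: Balaban1982Higgs2, (2.61) p.571; (2.44) p.566; (2.55) p.570] -/
theorem term2_59 (hP : P.Valid) (hR : m.Restr) {x : X} (hx : x ∈ m.good) :
    |(∑ y' ∈ m.T, m.K x y' * (1 - m.ζ x y')) * m.A (m.blk x)| ≤ 2 * P.c₀ * P.S * P.K₂ * m.q := by
  have hc₀ := hP.c₀_nonneg
  have hS := hP.S_nonneg
  have hfar : |∑ y' ∈ m.T, m.K x y' * (1 - m.ζ x y')| ≤ P.c₀ * Real.exp (-(P.δ / 2 * m.ρ₁)) * 2 * P.S := by
    refine far_sum_bound (d := fun y' => m.d x y') hc₀ hP.δ_pos.le (by norm_num : (0 : ℝ) ≤ 2) ?_ ?_ ?_ (m.summable x)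
    · intro y' hy'; exact m.kerK x hx y' hy'
    · intro y' hy' hne
      by_contra hlt
      push Not at hlt
      exact hne (by rw [m.zeta_one x y' hy' hlt.le]; ring)
    · intro y' _
      have h1 := m.zeta_abs x y'
      calc |1 - m.ζ x y'| ≤ |(1 : ℝ)| + |m.ζ x y'| := abs_sub _ _
        _ ≤ 1 + 1 := by rw [abs_one]; linarith
        _ = 2 := by norm_num
  -- e^{−½δ₀ρ₁} ≤ e^{−½δ₀(ρ₁ − 1)}
  have hexp : Real.exp (-(P.δ / 2 * m.ρ₁)) ≤ Real.exp (-(P.δ / 2 * (m.ρ₁ - 1))) := by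
    rw [Real.exp_le_exp]; nlinarith [hP.δ_pos]
  have hsep : Real.exp (-(P.δ / 2 * m.ρ₁)) * m.tA ≤ P.K₂ :=
    (mul_le_mul_of_nonneg_right hexp m.tA_nonneg).trans m.sep
  have hA := hR.bound (m.blk x) (m.blk_mem x hx)
  calc |(∑ y' ∈ m.T, m.K x y' * (1 - m.ζ x y')) * m.A (m.blk x)|
      = |∑ y' ∈ m.T, m.K x y' * (1 - m.ζ x y')| * |m.A (m.blk x)| := abs_mul _ _
    _ ≤ (P.c₀ * Real.exp (-(P.δ / 2 * m.ρ₁)) * 2 * P.S) * (m.tA * m.q) :=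
        mul_le_mul hfar hA (abs_nonneg _) (by positivity)
    _ = 2 * P.c₀ * P.S * (Real.exp (-(P.δ / 2 * m.ρ₁)) * m.tA) * m.q := by ring
    _ ≤ 2 * P.c₀ * P.S * P.K₂ * m.q :=
        mul_le_mul_of_nonneg_right (mul_le_mul_of_nonneg_left hsep (by positivity)) m.q_nonneg

/-- TERM 3 of (2.61) with (2.63): `|a_k(G_kQ_k^*1)(x)A(y) − A(y)| = |κ − 1||A(y)| ≤ K₁·p(L^{k−1}ε)`.
[cite: Balaban1982Higgs2, (2.61)+(2.63) p.571] -/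
theorem term3_59 (hR : m.Restr) {x : X} (hx : x ∈ m.good) :
    |(∑ y' ∈ m.T, m.K x y') * m.A (m.blk x) - m.A (m.blk x)| ≤ P.K₁ * m.q := by
  rw [m.sumK x hx]
  have hA := hR.bound (m.blk x) (m.blk_mem x hx)
  calc |m.κ * m.A (m.blk x) - m.A (m.blk x)| = |m.κ - 1| * |m.A (m.blk x)| := by
        rw [← abs_mul]; congr 1; ring
    _ ≤ |m.κ - 1| * (m.tA * m.q) := mul_le_mul_of_nonneg_left hA (abs_nonneg _)
    _ = (|m.κ - 1| * m.tA) * m.q := by ring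
    _ ≤ P.K₁ * m.q := mul_le_mul_of_nonneg_right m.kappa m.q_nonneg

/-- **(2.59) pointwise at scale p(L^{k−1}ε)**: `|A^{(k)}(x) − A(y)| ≤ O59·p(L^{k−1}ε)` for `x ∈ B^k(Λ₂^{(k−1)′})`, via (2.61)
term by term. [cite: Balaban1982Higgs2, Lemma 2.3 (2.59) p.571] -/
theorem lemma23_pointwise_q (hP : P.Valid) (hR : m.Restr) {x : X} (hx : x ∈ m.good) :
    |m.Ak x - m.A (m.blk x)| ≤ P.O59 * m.q := by
  have h1 := m.term1_59 hP hR hx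
  have h2 := m.term2_59 hP hR hx
  have h3 := m.term3_59 hR hx
  unfold Ak
  rw [eq261 m.T (m.ζ x) (m.K x) m.A (m.A (m.blk x))]
  set t1 := ∑ y' ∈ m.T, m.ζ x y' * m.K x y' * (m.A y' - m.A (m.blk x))
  set t2 := (∑ y' ∈ m.T, m.K x y' * (1 - m.ζ x y')) * m.A (m.blk x)
  set t3 := (∑ y' ∈ m.T, m.K x y') * m.A (m.blk x)
  have hre : t1 - t2 + t3 - m.A (m.blk x) = t1 + (-t2) + (t3 - m.A (m.blk x)) := by ring
  rw [hre]
  calc |t1 + (-t2) + (t3 - m.A (m.blk x))| ≤ |t1| + |-t2| + |t3 - m.A (m.blk x)| := by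
        have e1 := abs_add_le (t1 + (-t2)) (t3 - m.A (m.blk x))
        have e2 := abs_add_le t1 (-t2)
        linarith
    _ ≤ P.c₀ * m.q * (P.r₁ + P.r₂ * (2 / P.δ)) * P.S + 2 * P.c₀ * P.S * P.K₂ * m.q + P.K₁ * m.q := by
        rw [abs_neg]; exact add_le_add (add_le_add h1 h2) h3
    _ = P.O59 * m.q := by unfold Consts23.O59; ring

/-- **Lemma 2.3 (2.59) pointwise, PROVED for the model**: under the restrictions (2.55), for every `x ∈ B^k(Λ₂^{(k−1)′})` (with `y`
its block) `|A^{(k)}(x) − A(y)| ≤ 𝒞·p(L^kε)`, `𝒞 = Consts23.O1 P` independent of the instance.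
[cite: Balaban1982Higgs2, Lemma 2.3 (2.59) p.571] -/
theorem lemma23_pointwise (hP : P.Valid) (hR : m.Restr) {x : X} (hx : x ∈ m.good) :
    |m.Ak x - m.A (m.blk x)| ≤ P.O1 * m.p := by
  have h := m.lemma23_pointwise_q hP hR hx
  have h59 := Consts23.O59_nonneg hP
  have h60 := Consts23.O60_nonneg hP
  have hK₃ := hP.K₃_nonneg
  have hp := m.p_nonneg
  calc |m.Ak x - m.A (m.blk x)| ≤ P.O59 * m.q := h
    _ ≤ P.O59 * (P.K₃ * m.p) := mul_le_mul_of_nonneg_left m.q_le h59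
    _ ≤ P.O1 * m.p := by unfold Consts23.O1; nlinarith [mul_nonneg (mul_nonneg hK₃ h60) hp]

/-- The second form of (2.59): `A^{(k)}(x) = (Q_k^*A)(x) + O(p(L^kε))`. [cite: Balaban1982Higgs2, Lemma 2.3 (2.59) p.571] -/
theorem lemma23_pointwise_QsA (hP : P.Valid) (hR : m.Restr) {x : X} (hx : x ∈ m.good) :
    |m.Ak x - m.QsA x| ≤ P.O1 * m.p :=
  m.lemma23_pointwise hP hR hx

/-! ### The two terms of (2.64) -/

/-- The kernel of `a_k∂^η_μ(ζ^{(k)}G_kQ_k^*)`: `η⁻¹(ζK(x + ηe_μ, y′) − ζK(x, y′))` is bounded by `c₀(e^{δ₀} + 1)e^{−δ₀|x−y′|}` —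
the discrete Leibniz rule with |∂^η_xζ^{(k)}| ≤ 1, |ζ^{(k)}| ≤ 1 and Proposition 2.2 for G_kQ_k^* (at the shifted point, one
lattice step away) and for ∂^ηG_kQ_k^*. [cite: Balaban1982Higgs2, (2.64) p.571; (2.44) p.566; (2.58) p.570] -/
theorem dzeta_bound (hP : P.Valid) (μ : Dir) {x : X} (hx : x ∈ m.good) {y' : Y} (hy' : y' ∈ m.T) :
    |m.η⁻¹ * (m.ζ (m.sh μ x) y' * m.K (m.sh μ x) y' - m.ζ x y' * m.K x y')| ≤
      P.c₀ * (Real.exp P.δ + 1) * Real.exp (-(P.δ * m.d x y')) := by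
  have hη := m.η_pos
  have hc₀ := hP.c₀_nonneg
  set E := Real.exp (-(P.δ * m.d x y')) with hE
  have hE0 : 0 ≤ E := (Real.exp_pos _).le
  -- the two pieces of the Leibniz rule
  have hKsh : |m.K (m.sh μ x) y'| ≤ P.c₀ * (Real.exp P.δ * E) :=
    (m.kerK_sh μ x hx y' hy').trans
      (mul_le_mul_of_nonneg_left (exp_neg_shift_le hP.δ_pos.le (m.d_le_sh μ x y')) hc₀)
  have hdζ : |m.η⁻¹ * (m.ζ (m.sh μ x) y' - m.ζ x y')| ≤ 1 := by
    rw [abs_mul, abs_of_pos (inv_pos.mpr hη)]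
    calc m.η⁻¹ * |m.ζ (m.sh μ x) y' - m.ζ x y'| ≤ m.η⁻¹ * m.η :=
          mul_le_mul_of_nonneg_left (m.zeta_lip μ x y' hy') (inv_pos.mpr hη).le
      _ = 1 := inv_mul_cancel₀ hη.ne'
  have hdK : |m.η⁻¹ * (m.K (m.sh μ x) y' - m.K x y')| ≤ P.c₀ * E := by
    rw [abs_mul, abs_of_pos (inv_pos.mpr hη)]
    calc m.η⁻¹ * |m.K (m.sh μ x) y' - m.K x y'| ≤ m.η⁻¹ * (m.η * (P.c₀ * E)) :=
          mul_le_mul_of_nonneg_left (m.kerDK μ x hx y' hy') (inv_pos.mpr hη).le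
      _ = P.c₀ * E := by field_simp
  have hζ := m.zeta_abs x y'
  have hsplit : m.η⁻¹ * (m.ζ (m.sh μ x) y' * m.K (m.sh μ x) y' - m.ζ x y' * m.K x y') =
      (m.η⁻¹ * (m.ζ (m.sh μ x) y' - m.ζ x y')) * m.K (m.sh μ x) y' +
        m.ζ x y' * (m.η⁻¹ * (m.K (m.sh μ x) y' - m.K x y')) := by ring
  rw [hsplit]
  calc |(m.η⁻¹ * (m.ζ (m.sh μ x) y' - m.ζ x y')) * m.K (m.sh μ x) y' +
          m.ζ x y' * (m.η⁻¹ * (m.K (m.sh μ x) y' - m.K x y'))|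
      ≤ |m.η⁻¹ * (m.ζ (m.sh μ x) y' - m.ζ x y')| * |m.K (m.sh μ x) y'| +
          |m.ζ x y'| * |m.η⁻¹ * (m.K (m.sh μ x) y' - m.K x y')| := by
        refine (abs_add_le _ _).trans (le_of_eq ?_)
        rw [abs_mul (m.η⁻¹ * (m.ζ (m.sh μ x) y' - m.ζ x y')) (m.K (m.sh μ x) y'),
          abs_mul (m.ζ x y') (m.η⁻¹ * (m.K (m.sh μ x) y' - m.K x y'))]
    _ ≤ 1 * (P.c₀ * (Real.exp P.δ * E)) + 1 * (P.c₀ * E) :=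
        add_le_add (mul_le_mul hdζ hKsh (abs_nonneg _) zero_le_one)
          (mul_le_mul hζ hdK (abs_nonneg _) zero_le_one)
    _ = P.c₀ * (Real.exp P.δ + 1) * E := by ring

/-- TERM 1 of (2.64): `|a_k(∂^η_μζ^{(k)}G_kQ_k^*(A − A(y)))(x)| ≤ c₀(e^{δ₀} + 1)(r₁ + 2r₂/δ₀)S·p(L^{k−1}ε)` — the kernel bound
`dzeta_bound`, the support of ζ^{(k)} (both at x and at x + ηe_μ) and the integrated restriction (2.55)₁ (ENGINE 2).
[cite: Balaban1982Higgs2, (2.64) p.571; (2.55) p.570] -/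
theorem term1_64 (hP : P.Valid) (hR : m.Restr) (μ : Dir) {x : X} (hx : x ∈ m.good) :
    |∑ y' ∈ m.T, m.η⁻¹ * (m.ζ (m.sh μ x) y' * m.K (m.sh μ x) y' - m.ζ x y' * m.K x y') * (m.A y' - m.A (m.blk x))| ≤
      P.c₀ * (Real.exp P.δ + 1) * m.q * (P.r₁ + P.r₂ * (2 / P.δ)) * P.S := by
  set near := m.T.filter (fun y' => m.d x y' ≤ m.ρ + 1) with hnear
  set D : Y → ℝ := fun y' => m.η⁻¹ * (m.ζ (m.sh μ x) y' * m.K (m.sh μ x) y' - m.ζ x y' * m.K x y') with hD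
  -- beyond ρ + 1 both cutoffs vanish
  have hrestrict : ∑ y' ∈ near, D y' * (m.A y' - m.A (m.blk x)) = ∑ y' ∈ m.T, D y' * (m.A y' - m.A (m.blk x)) := by
    refine Finset.sum_filter_of_ne fun y' hy' hne => ?_
    by_contra hlt
    push Not at hlt
    have hζx : m.ζ x y' = 0 := by
      by_contra h; exact absurd (m.zeta_supp x y' hy' h) (by linarith)
    have hζs : m.ζ (m.sh μ x) y' = 0 := by
      by_contra h
      have := m.zeta_supp (m.sh μ x) y' hy' h
      have := m.d_le_sh μ x y'
      linarith
    apply hne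
    rw [hD]; simp only [hζx, hζs, zero_mul, sub_zero, mul_zero, zero_mul]
  have hsumNear : ∑ y' ∈ near, Real.exp (-(P.δ / 2 * m.d x y')) ≤ P.S :=
    le_trans (Finset.sum_le_sum_of_subset_of_nonneg (Finset.filter_subset _ _) fun _ _ _ => (Real.exp_pos _).le)
      (m.summable x)
  have hc₀' : 0 ≤ P.c₀ * (Real.exp P.δ + 1) := mul_nonneg hP.c₀_nonneg (by positivity)
  rw [← hrestrict]
  refine lipschitz_sum_bound (S := near) (K := D) (g := fun y' => m.A y' - m.A (m.blk x)) (d := fun y' => m.d x y')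
    hc₀' hP.δ_pos m.q_nonneg hP.r₁_nonneg hP.r₂_nonneg (fun y' _ => m.d_nonneg x y') ?_ ?_ hsumNear
  · intro y' hy'
    exact m.dzeta_bound hP μ hx (Finset.mem_filter.mp hy').1
  · intro y' hy'
    obtain ⟨hyT, hle⟩ := Finset.mem_filter.mp hy'
    exact hR.lipschitz x hx y' hyT hle

/-- TERM 2 of (2.64): `|a_k(∂^η_μ(1 − ζ^{(k)})G_kQ_k^*1)(x)·A(y)| ≤ c₀(e^{δ₀} + 2)SK₂·p(L^{k−1}ε)` — the kernel
`η⁻¹((1−ζ)K(x + ηe_μ, y′) − (1−ζ)K(x, y′))` vanishes for |x − y′| ≤ ½r(L^kε) − 1 (there ζ^{(k)} = 1 at both points) and is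
`≤ c₀(e^{δ₀} + 2)e^{−δ₀|x−y′|}` otherwise (ENGINE 1′), and the radius beats |A(y)| ≤ c₁/(μ₀L^{k−1}ε)·p.
[cite: Balaban1982Higgs2, (2.64) p.571; (2.44) p.566; (2.55) p.570] -/
theorem term2_64 (hP : P.Valid) (hR : m.Restr) (μ : Dir) {x : X} (hx : x ∈ m.good) :
    |(∑ y' ∈ m.T, m.η⁻¹ * (m.K (m.sh μ x) y' * (1 - m.ζ (m.sh μ x) y') - m.K x y' * (1 - m.ζ x y'))) * m.A (m.blk x)| ≤
      P.c₀ * (Real.exp P.δ + 2) * P.S * P.K₂ * m.q := by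
  have hη := m.η_pos
  have hc₀ := hP.c₀_nonneg
  have hS := hP.S_nonneg
  have hc₀' : 0 ≤ P.c₀ * (Real.exp P.δ + 2) := mul_nonneg hc₀ (by positivity)
  set D' : Y → ℝ := fun y' =>
    m.η⁻¹ * (m.K (m.sh μ x) y' * (1 - m.ζ (m.sh μ x) y') - m.K x y' * (1 - m.ζ x y')) with hD'
  have hfar : |∑ y' ∈ m.T, D' y'| ≤ P.c₀ * (Real.exp P.δ + 2) * Real.exp (-(P.δ / 2 * (m.ρ₁ - 1))) * P.S := by
    refine far_kernel_sum_bound (d := fun y' => m.d x y') hc₀' hP.δ_pos.le ?_ ?_ (m.summable x)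
    · -- |D′| ≤ |η⁻¹ΔK| + |η⁻¹Δ(ζK)| ≤ c₀e^{−δd} + c₀(e^{δ}+1)e^{−δd}
      intro y' hy'
      have hsplit : D' y' = m.η⁻¹ * (m.K (m.sh μ x) y' - m.K x y') -
          m.η⁻¹ * (m.ζ (m.sh μ x) y' * m.K (m.sh μ x) y' - m.ζ x y' * m.K x y') := by rw [hD']; ring
      have hdK : |m.η⁻¹ * (m.K (m.sh μ x) y' - m.K x y')| ≤ P.c₀ * Real.exp (-(P.δ * m.d x y')) := by
        rw [abs_mul, abs_of_pos (inv_pos.mpr hη)]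
        calc m.η⁻¹ * |m.K (m.sh μ x) y' - m.K x y'| ≤ m.η⁻¹ * (m.η * (P.c₀ * Real.exp (-(P.δ * m.d x y')))) :=
              mul_le_mul_of_nonneg_left (m.kerDK μ x hx y' hy') (inv_pos.mpr hη).le
          _ = P.c₀ * Real.exp (-(P.δ * m.d x y')) := by field_simp
      have hdζ := m.dzeta_bound hP μ hx hy'
      rw [hsplit]
      calc |m.η⁻¹ * (m.K (m.sh μ x) y' - m.K x y') -
              m.η⁻¹ * (m.ζ (m.sh μ x) y' * m.K (m.sh μ x) y' - m.ζ x y' * m.K x y')|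
          ≤ |m.η⁻¹ * (m.K (m.sh μ x) y' - m.K x y')| +
              |m.η⁻¹ * (m.ζ (m.sh μ x) y' * m.K (m.sh μ x) y' - m.ζ x y' * m.K x y')| := abs_sub _ _
        _ ≤ P.c₀ * Real.exp (-(P.δ * m.d x y')) + P.c₀ * (Real.exp P.δ + 1) * Real.exp (-(P.δ * m.d x y')) :=
            add_le_add hdK hdζ
        _ = P.c₀ * (Real.exp P.δ + 2) * Real.exp (-(P.δ * m.d x y')) := by ring
    · -- within ρ₁ − 1 both cutoffs are 1, so D′ = 0
      intro y' hy' hne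
      by_contra hlt
      push Not at hlt
      have hζx : m.ζ x y' = 1 := m.zeta_one x y' hy' (by linarith)
      have hζs : m.ζ (m.sh μ x) y' = 1 := m.zeta_one (m.sh μ x) y' hy' (by linarith [m.sh_le_d μ x y'])
      apply hne
      rw [hD']; simp only [hζx, hζs, sub_self, mul_zero]
  have hA := hR.bound (m.blk x) (m.blk_mem x hx)
  calc |(∑ y' ∈ m.T, D' y') * m.A (m.blk x)| = |∑ y' ∈ m.T, D' y'| * |m.A (m.blk x)| := abs_mul _ _
    _ ≤ (P.c₀ * (Real.exp P.δ + 2) * Real.exp (-(P.δ / 2 * (m.ρ₁ - 1))) * P.S) * (m.tA * m.q) :=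
        mul_le_mul hfar hA (abs_nonneg _) (by positivity)
    _ = P.c₀ * (Real.exp P.δ + 2) * P.S * (Real.exp (-(P.δ / 2 * (m.ρ₁ - 1))) * m.tA) * m.q := by ring
    _ ≤ P.c₀ * (Real.exp P.δ + 2) * P.S * P.K₂ * m.q :=
        mul_le_mul_of_nonneg_right (mul_le_mul_of_nonneg_left m.sep (by positivity)) m.q_nonneg

/-- **(2.60) pointwise at scale p(L^{k−1}ε)**: `|(∂^η_μA^{(k)})(x)| ≤ O60·p(L^{k−1}ε)` for `x ∈ B^k(Λ₂^{(k−1)′})`, via (2.64): the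
third term of (2.61) drops out «because G_kQ_k^*1 is a constant» (`sumK`, `sumK_sh`). [cite: Balaban1982Higgs2, (2.60), (2.64) p.571] -/
theorem lemma23_deriv_pointwise_q (hP : P.Valid) (hR : m.Restr) (μ : Dir) {x : X} (hx : x ∈ m.good) :
    |m.dAk μ x| ≤ P.O60 * m.q := by
  have h1 := m.term1_64 hP hR μ hx
  have h2 := m.term2_64 hP hR μ hx
  unfold dAk Ak
  rw [eq264 m.T (m.ζ x) (m.K x) (m.ζ (m.sh μ x)) (m.K (m.sh μ x)) m.A (m.A (m.blk x)) m.η, m.sumK x hx,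
    m.sumK_sh μ x hx, sub_self, mul_zero, zero_mul, add_zero]
  set t1 := ∑ y' ∈ m.T, m.η⁻¹ * (m.ζ (m.sh μ x) y' * m.K (m.sh μ x) y' - m.ζ x y' * m.K x y') * (m.A y' - m.A (m.blk x))
  set t2 := (∑ y' ∈ m.T, m.η⁻¹ * (m.K (m.sh μ x) y' * (1 - m.ζ (m.sh μ x) y') - m.K x y' * (1 - m.ζ x y'))) *
    m.A (m.blk x)
  calc |t1 - t2| ≤ |t1| + |t2| := abs_sub _ _
    _ ≤ P.c₀ * (Real.exp P.δ + 1) * m.q * (P.r₁ + P.r₂ * (2 / P.δ)) * P.S +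
          P.c₀ * (Real.exp P.δ + 2) * P.S * P.K₂ * m.q := add_le_add h1 h2
    _ = P.O60 * m.q := by unfold Consts23.O60; ring

/-- **Lemma 2.3 (2.60) pointwise, PROVED for the model**: under (2.55), `|(∂^η_μA^{(k)})(x)| ≤ 𝒞·p(L^kε)` on B^k(Λ₂^{(k−1)′}).
[cite: Balaban1982Higgs2, Lemma 2.3 (2.60) p.571] -/
theorem lemma23_deriv_pointwise (hP : P.Valid) (hR : m.Restr) (μ : Dir) {x : X} (hx : x ∈ m.good) :
    |m.dAk μ x| ≤ P.O1 * m.p := by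
  have h := m.lemma23_deriv_pointwise_q hP hR μ hx
  have h59 := Consts23.O59_nonneg hP
  have h60 := Consts23.O60_nonneg hP
  have hK₃ := hP.K₃_nonneg
  have hp := m.p_nonneg
  calc |m.dAk μ x| ≤ P.O60 * m.q := h
    _ ≤ P.O60 * (P.K₃ * m.p) := mul_le_mul_of_nonneg_left m.q_le h60
    _ ≤ P.O1 * m.p := by unfold Consts23.O1; nlinarith [mul_nonneg (mul_nonneg hK₃ h59) hp]

/-! ### The suprema entering the row's carrier -/

/-- `sup over y ∈ Λ₂^{(k−1)′}, x ∈ B^k(y) of |A^{(k)}(x) − A(y)|` — the real number `B2Sect2Statements.L23Setting.dev259a` stands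
for, in the model (a supremum over the finite set `good`; `0` if it is empty). [cite: Balaban1982Higgs2, Lemma 2.3 (2.59) p.571] -/
noncomputable def dev259a : ℝ := ⨆ x : m.good, |m.Ak x - m.A (m.blk x)|

/-- The same supremum for the second form `|A^{(k)}(x) − (Q_k^*A)(x)|` (`dev259b`). [cite: Balaban1982Higgs2, Lemma 2.3 (2.59) p.571] -/
noncomputable def dev259b : ℝ := ⨆ x : m.good, |m.Ak x - m.QsA x|

/-- `sup over x ∈ B^k(Λ₂^{(k−1)′}), μ of |(∂^η_μA^{(k)})(x)|` (`dev260`). [cite: Balaban1982Higgs2, Lemma 2.3 (2.60) p.571] -/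
noncomputable def dev260 : ℝ := ⨆ i : Dir × m.good, |m.dAk i.1 i.2|

/-- [cite: Balaban1982Higgs2, Lemma 2.3 (2.59) p.571] -/
theorem dev259a_le (hP : P.Valid) (hR : m.Restr) : m.dev259a ≤ P.O1 * m.p := by
  unfold dev259a
  exact Real.iSup_le (fun x => m.lemma23_pointwise hP hR x.2) (mul_nonneg (Consts23.O1_nonneg hP) m.p_nonneg)

/-- [cite: Balaban1982Higgs2, Lemma 2.3 (2.59) p.571] -/
theorem dev259b_le (hP : P.Valid) (hR : m.Restr) : m.dev259b ≤ P.O1 * m.p := by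
  unfold dev259b
  exact Real.iSup_le (fun x => m.lemma23_pointwise_QsA hP hR x.2) (mul_nonneg (Consts23.O1_nonneg hP) m.p_nonneg)

/-- [cite: Balaban1982Higgs2, Lemma 2.3 (2.60) p.571] -/
theorem dev260_le (hP : P.Valid) (hR : m.Restr) : m.dev260 ≤ P.O1 * m.p := by
  unfold dev260
  exact Real.iSup_le (fun i => m.lemma23_deriv_pointwise hP hR i.1 i.2.2)
    (mul_nonneg (Consts23.O1_nonneg hP) m.p_nonneg)

end KernelModel23

/-! ## §3. Row B2.Lem2.3: the decl of record (r02) and its twin (r14), for the model family -/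

/-- The family of instances of §2 read through the row's carrier `B2Sect2Statements.L23Setting` (r02, decl of record):
`p` ↤ p(L^kε), `restr255` ↤ the restrictions (2.55) (`KernelModel23.Restr`), `dev259a`/`dev259b`/`dev260` ↤ the suprema of §2.
[cite: Balaban1982Higgs2, Lemma 2.3 (2.59)–(2.60) p.571] -/
noncomputable def famOf (P : Consts23) (X Y Dir : Type) (m : KernelModel23 P X Y Dir) : B2Sect2Statements.L23Setting where
  p := m.p
  restr255 := m.Restr
  dev259a := m.dev259a
  dev259b := m.dev259b
  dev260 := m.dev260

/-- **Row B2.Lem2.3 — Lemma 2.3 (2.59)–(2.60) AS TYPED by the decl of record, PROVED for the model family**: for fixed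
constants `P` the family of ALL instances `KernelModel23 P X Y Dir` satisfies `B2Sect2Statements.Lemma23Printed`, with the
uniform constant `Consts23.O1 P`. [cite: Balaban1982Higgs2, Lemma 2.3 (2.59)–(2.60) p.571] -/
theorem lemma23Printed_model (P : Consts23) (hP : P.Valid) (X Y Dir : Type) :
    B2Sect2Statements.Lemma23Printed (famOf P X Y Dir) :=
  ⟨P.O1, fun m hR => ⟨m.dev259a_le hP hR, m.dev259b_le hP hR, m.dev260_le hP hR⟩⟩

/-- The same family read through r14's twin carrier `B2StepK.L23Setting` (per-point form: `inL2 y` ↤ "the block B^k(y) lies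
in B^k(Λ₂^{(k−1)′})", `dAk μ x` ↤ |(∂^η_μA^{(k)})(x)|). [cite: Balaban1982Higgs2, Lemma 2.3 (2.59)–(2.60) p.571] -/
noncomputable def famOfStepK (P : Consts23) (X Y Dir : Type) (m : KernelModel23 P X Y Dir) : B2StepK.L23Setting where
  X := X
  Y := Y
  Dir := Dir
  blk := m.blk
  inL2 := fun y => ∀ x : X, m.blk x = y → x ∈ m.good
  Ak := m.Ak
  A := m.A
  QsA := m.QsA
  dAk := fun μ x => |m.dAk μ x|
  p := m.p
  restr := m.Restr

/-- **Row B2.Lem2.3 for r14's twin statement `B2StepK.Lemma23Printed`, PROVED for the model family** (same constant).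
[cite: Balaban1982Higgs2, Lemma 2.3 (2.59)–(2.60) p.571] -/
theorem lemma23Printed_model_StepK (P : Consts23) (hP : P.Valid) (X Y Dir : Type) :
    B2StepK.Lemma23Printed (famOfStepK P X Y Dir) := by
  refine ⟨P.O1, fun m hR => ⟨fun x hx => ?_, fun μ x hx => ?_⟩⟩
  · have hxg : x ∈ m.good := hx x rfl
    exact ⟨m.lemma23_pointwise hP hR hxg, m.lemma23_pointwise_QsA hP hR hxg⟩
  · have hxg : x ∈ m.good := hx x rfl
    exact m.lemma23_deriv_pointwise hP hR μ hxg

/-! ## §4. Discharging the two scale fields: (2.63) ⇒ `kappa`, the radius ½r(L^kε) ⇒ `sep` -/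

/-- **(2.63) ⇒ the `kappa` field.**  With the printed value κ = a_kG_kQ_k^*1 = 1 − μ₀²ℓ²/(a_k + μ₀²ℓ²) (ℓ = L^kε; module-algebra
form `B2.display263`) and the threshold tA = c₁/(μ₀L^{k−1}ε) = c₁L/(μ₀ℓ) of (2.55)₂: `|κ − 1|·tA ≤ c₁Lμ₀ℓ/a_k ≤ c₁L/a_k` as
soon as μ₀ℓ ≤ 1 — so `K₁ = c₁L/a_k` (with a_k ≥ a(1 − L⁻²)) serves every step. [cite: Balaban1982Higgs2, (2.63) p.571; (2.55) p.570] -/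
theorem kappa_of_display263 {ak μ₀ ℓ c₁ L : ℝ} (hak : 0 < ak) (hμ₀ : 0 < μ₀) (hℓ : 0 < ℓ) (hc₁ : 0 ≤ c₁) (hL : 0 ≤ L)
    (hμℓ : μ₀ * ℓ ≤ 1) :
    |(1 - μ₀ ^ 2 * ℓ ^ 2 / (ak + μ₀ ^ 2 * ℓ ^ 2)) - 1| * (c₁ * L / (μ₀ * ℓ)) ≤ c₁ * L / ak := by
  have ht : 0 ≤ μ₀ ^ 2 * ℓ ^ 2 := by positivity
  have habs : |(1 - μ₀ ^ 2 * ℓ ^ 2 / (ak + μ₀ ^ 2 * ℓ ^ 2)) - 1| = μ₀ ^ 2 * ℓ ^ 2 / (ak + μ₀ ^ 2 * ℓ ^ 2) := by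
    rw [show (1 - μ₀ ^ 2 * ℓ ^ 2 / (ak + μ₀ ^ 2 * ℓ ^ 2)) - 1 = -(μ₀ ^ 2 * ℓ ^ 2 / (ak + μ₀ ^ 2 * ℓ ^ 2)) by ring,
      abs_neg, abs_of_nonneg (by positivity)]
  have hfrac : μ₀ ^ 2 * ℓ ^ 2 / (ak + μ₀ ^ 2 * ℓ ^ 2) ≤ μ₀ ^ 2 * ℓ ^ 2 / ak :=
    div_le_div_of_nonneg_left ht hak (by linarith)
  have hμℓ0 : 0 < μ₀ * ℓ := mul_pos hμ₀ hℓ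
  rw [habs]
  calc μ₀ ^ 2 * ℓ ^ 2 / (ak + μ₀ ^ 2 * ℓ ^ 2) * (c₁ * L / (μ₀ * ℓ))
      ≤ μ₀ ^ 2 * ℓ ^ 2 / ak * (c₁ * L / (μ₀ * ℓ)) := mul_le_mul_of_nonneg_right hfrac (by positivity)
    _ = c₁ * L / ak * (μ₀ * ℓ) := by field_simp
    _ ≤ c₁ * L / ak * 1 := mul_le_mul_of_nonneg_left hμℓ (by positivity)
    _ = c₁ * L / ak := mul_one _

/-- **The radius ⇒ the `sep` field.**  If `2ρ₁ ≥ r(ℓ)` (ρ₁ = ½r(L^kε), ℓ = L^kε) and exp(−¼δ₀r(ℓ)) ≤ C₁ℓ (r14's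
`RDecayBeatsPowers` at rate ¼δ₀ and κ = 1: `exists_C₁_rDecay4`), then with tA = c₁L/(μ₀ℓ):
`e^{−½δ₀(ρ₁ − 1)}·tA ≤ e^{½δ₀}c₁LC₁/μ₀` — so `K₂ = e^{½δ₀}c₁LC₁/μ₀` serves every step.
[cite: Balaban1982Higgs2, (2.44) p.566; (2.7) p.558; (2.109) p.580] -/
theorem sep23_of_rDecay {δ Rr r ℓ μ₀ c₁ L ρ₁ C₁ : ℝ} (hδ : 0 ≤ δ) (hμ₀ : 0 < μ₀) (hℓ : 0 < ℓ) (hc₁ : 0 ≤ c₁) (hL : 0 ≤ L)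
    (hρ₁ : B2.rFn Rr r ℓ ≤ 2 * ρ₁) (hC₁ : Real.exp (-(δ / 4 * B2.rFn Rr r ℓ)) ≤ C₁ * ℓ) :
    Real.exp (-(δ / 2 * (ρ₁ - 1))) * (c₁ * L / (μ₀ * ℓ)) ≤ Real.exp (δ / 2) * c₁ * L * C₁ / μ₀ := by
  have h1 : Real.exp (-(δ / 2 * (ρ₁ - 1))) ≤ Real.exp (δ / 2) * (C₁ * ℓ) := by
    have h0 : Real.exp (-(δ / 2 * (ρ₁ - 1))) = Real.exp (δ / 2) * Real.exp (-(δ / 2 * ρ₁)) := by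
      rw [← Real.exp_add]; congr 1; ring
    rw [h0]
    refine mul_le_mul_of_nonneg_left (le_trans ?_ hC₁) (Real.exp_pos _).le
    rw [Real.exp_le_exp]
    nlinarith [mul_le_mul_of_nonneg_left hρ₁ (by positivity : (0 : ℝ) ≤ δ / 4)]
  have hμℓ : 0 < μ₀ * ℓ := mul_pos hμ₀ hℓ
  calc Real.exp (-(δ / 2 * (ρ₁ - 1))) * (c₁ * L / (μ₀ * ℓ))
      ≤ (Real.exp (δ / 2) * (C₁ * ℓ)) * (c₁ * L / (μ₀ * ℓ)) := mul_le_mul_of_nonneg_right h1 (by positivity)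
    _ = Real.exp (δ / 2) * c₁ * L * C₁ / μ₀ := by field_simp

/-- The κ = 1, rate ¼δ₀ instance of r14's `RDecayBeatsPowers` in the form used by `sep23_of_rDecay`: for δ₀ > 0 and the printed
ranges r > 1, R > 0 there is C₁ with exp(−¼δ₀r(ℓ)) ≤ C₁ℓ for all ℓ ∈ (0,1]. [cite: Balaban1982Higgs2, (2.109) p.580; (2.7) p.558] -/
theorem exists_C₁_rDecay4 {δ Rr r : ℝ} (hδ : 0 < δ) (hR : 0 < Rr) (hr : 1 < r) :
    ∃ C₁ : ℝ, ∀ ℓ : ℝ, 0 < ℓ → ℓ ≤ 1 → Real.exp (-(δ / 4 * B2.rFn Rr r ℓ)) ≤ C₁ * ℓ := by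
  obtain ⟨C, hC⟩ := B2StepK.rDecayBeatsPowers (by positivity : 0 < δ / 4) hR hr 1
  exact ⟨C, fun ℓ hℓ hℓ1 => by simpa [Real.rpow_one] using hC ℓ hℓ hℓ1⟩

end Literature.MathematicalPhysics.QuantumFieldTheory.Balaban1983to89.B2Lemma23Proof
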